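import Summits.NavierStokesRegularity.NavierStokesRegularity.Theorems.TargetDepletionLadderBoundedBiotSavart
import Summits.NavierStokesRegularity.NavierStokesRegularity.Theorems.TargetDepletionLadderBoundedDivCurlTools
import HarnessLib

/-!
# Crux `Target` (stmt-NavierStokesRegularity-1217), line `depletion_ladder`, stub S1 (registered class):
# `∇v ∈ L²` and `‖∇v‖₂ = ‖curl v‖₂` for BOUNDED divergence-free fields with square-integrable curl

`--supports stmt-NavierStokesRegularity-1217` (seat leafhand-ns-poloidalwindowdoor-3 g0, cell decomp-ns; step
(P2) of the registered-class programme for `stub_depletionBelowHalf`, on top of (P1)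
`…BoundedBiotSavart.exists_eq_const_add_biotSavart_curl` (this seat), the Galilean cut-off energy
identity `…C1DivCurl.integral_mul_frobeniusNormSq_sub_eq_hessian_sub_const` (p817482) and the tools of
`TargetDepletionLadderBoundedDivCurlTools.lean`).

The registered stub S1 quantifies over `C²` divergence-free `u : ℝ³ → ℝ³` with `‖u‖ ≤ M` and
`curl u ∈ L²`, but the depletion chain (`…StrainCubeSharpDepletion`) runs on `‖S‖₂² = ½‖ω‖₂²`, i.e. on
the whole-space `L²` div–curl identity `∫|Du|²_F = ∫‖curl u‖²`, which for NON-decaying `u` is the one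
analytic input the tree did not have (the landed forms ask `u ∈ L²`:
`…C1DivCurl.integral_frobeniusNormSq_fderiv_eq_of_contDiff_one`). Here it is proved for bounded fields:

* `exists_const_integrable_pow_six` — by (P1) `v = c + w` with `w = K₃ ∗ curl v`, and `w ∈ L⁶`
  (`K₃ ∗ : L² → L⁶`).
* `integrable_frobeniusNormSq_fderiv_of_bounded`, `integral_frobeniusNormSq_fderiv_eq_of_bounded`,
  `registered_gradient_sq_integrable_and_eq` — **for `v ∈ C²(ℝ³; ℝ³)` divergence free with `‖v‖ ≤ M`
  and `∫‖curl v‖² < ∞`: `|Dv|²_F ∈ L¹` and `∫ |Dv|²_F = ∫ ‖curl v‖²`.** Proof: the Galilean cut-off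
  identity gives `∫ χ_R(|Dv|²_F − ‖curl v‖²) = ∫ D²χ_R(w, w) =: E_R`, and
  `|E_R| ≤ 8C₂|B₁|a + C₂a⁻²ε_R` for every `a > 0` with `ε_R = ∫_{R ≤ |x| ≤ 2R} ‖w‖⁶ → 0`
  (`abs_integral_hessian_cutoff_le`, `tendsto_integral_shell_pow_six`): `a = 1` gives a bound uniform
  in `R`, hence `Dv ∈ L²` by exhaustion (`lintegral_ofReal_le_of_forall_integral_cutoff_mul_le`);
  `R → ∞` then `a → 0` gives `E_R → 0`, while the left side tends to `∫|Dv|²_F − ∫‖curl v‖²`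
  (dominated convergence, `χ_R → 1`).

WHAT THIS GIVES THE PROGRAMME: in the binders of `StretchingDepletion` one now has `‖∇u‖₂ = ‖ω‖₂` (this
file) and `‖∇ω‖₂ = ‖curl ω‖₂` (p817327); the remaining steps are P3 (`D²u ∈ L²`, p817327 applied to
`∂ₖu ∈ C¹ ∩ L²`), P4 (Betchov with cut-offs), P5 (the strain-cube integration by parts with cut-offs in
`C²`, no bounded-gradient hypothesis), P6 (assembly with `κ = (2+√3)/9 < 1/2`).

HONEST LABEL: helper (step P2 of an L/XL programme); closes no stub; no Navier–Stokes content;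
`Target`, S3 and NS regularity remain OPEN.

References: G. P. Galdi, *An Introduction to the Mathematical Theory of the Navier–Stokes Equations*
(2011), §II.6; H. Sohr, *The Navier–Stokes Equations* (2001), Lemma II.2.5.1; E. M. Stein (1970),
Ch. V §1.2 Thm 1. [folklore]
-/


noncomputable section

-- the summit and its single sub-problem share the name (CONVENTIONS §1)
set_option linter.dupNamespace false

open MeasureTheory Set Function Filter Metric Real InnerProductSpace Topology
open scoped ENNReal NNReal RealInnerProductSpace
open Literature.Analysis.FluidPDE Literature.Analysis.SingularIntegrals

namespace Summit.NavierStokesRegularity.NavierStokesRegularity.Theorems.DepletionLadder.BoundedDivCurl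

open Summit.NavierStokesRegularity.NavierStokesRegularity.Theorems.DepletionLadder.BoundedBiotSavart
open Summit.NavierStokesRegularity.NavierStokesRegularity.Theorems.DepletionLadder.C1DivCurl

/-! ### The `L²` div–curl estimate and identity for bounded fields -/

section Main

variable {v : (EuclideanSpace ℝ (Fin 3)) → (EuclideanSpace ℝ (Fin 3))}

/-- `‖f‖⁶ ∈ L¹` for a continuous `f` with `∫⁻ ‖f‖ₑ⁶ < ∞`. [folklore] -/
theorem integrable_pow_six_norm_of_lintegral_lt_top
    {f : EuclideanSpace ℝ (Fin 3) → EuclideanSpace ℝ (Fin 3)} (hf : Continuous f)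
    (h : ∫⁻ x, ‖f x‖ₑ ^ 6 < ⊤) : Integrable fun x => ‖f x‖ ^ 6 := by
  refine ⟨(hf.norm.pow 6).aestronglyMeasurable, ?_⟩
  refine (hasFiniteIntegral_iff_enorm).2 (lt_of_le_of_lt (le_of_eq ?_) h)
  refine lintegral_congr fun x => ?_
  rw [Real.enorm_eq_ofReal (by positivity), ← ofReal_norm, ENNReal.ofReal_pow (norm_nonneg _)]

/-- **The decaying part `w = v − c = K₃ ∗ curl v` of a bounded field lies in `L⁶`.** For `v ∈ C²`
divergence free, `‖v‖ ≤ M`, `‖curl v‖² ∈ L¹`: there is `c` with `v − c` continuous and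
`‖v − c‖⁶ ∈ L¹` (P1 + `K₃ ∗ : L² → L⁶`). [folklore] -/
theorem exists_const_integrable_pow_six (hv : ContDiff ℝ 2 v) (hdiv : VectorCalculus.IsDivFree v)
    {M : ℝ} (hM : ∀ y, ‖v y‖ ≤ M) (hω2 : Integrable fun y => ‖curl v y‖ ^ 2) :
    ∃ c : EuclideanSpace ℝ (Fin 3), Integrable fun x => ‖v x - c‖ ^ 6 := by
  obtain ⟨c, hc⟩ := exists_eq_const_add_biotSavart_curl_of_integrable_sq hv hdiv hM hω2
  refine ⟨c, ?_⟩
  have hv1 : ContDiff ℝ 1 v := hv.of_le (by norm_num)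
  have hωc : Continuous (curl v) := continuous_curl hv1
  have heq : (fun x => v x - c) = biotSavart (curl v) := by
    funext x
    rw [hc x, add_sub_cancel_left]
  rw [show (fun x => ‖v x - c‖ ^ 6) = fun x => ‖biotSavart (curl v) x‖ ^ 6 by
    funext x; rw [← heq]]
  have hcont : Continuous (biotSavart (curl v)) := by
    rw [← heq]; exact hv.continuous.sub continuous_const
  refine integrable_pow_six_norm_of_lintegral_lt_top hcont ?_
  obtain ⟨C, hC, hL6⟩ := exists_lintegral_enorm_biotSavart_pow_six_le
  have hω2' : ∫⁻ y, ‖curl v y‖ₑ ^ 2 < ⊤ := by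
    have h := hω2.hasFiniteIntegral
    rw [hasFiniteIntegral_iff_enorm] at h
    refine lt_of_le_of_lt (le_of_eq ?_) h
    refine lintegral_congr fun y => ?_
    rw [Real.enorm_eq_ofReal (sq_nonneg _), ← ofReal_norm, ENNReal.ofReal_pow (norm_nonneg _)]
  refine lt_of_le_of_lt (hL6 (curl v) hωc.aestronglyMeasurable) ?_
  exact ENNReal.mul_lt_top hC (ENNReal.pow_lt_top hω2')

/-- **The `L²` div–curl ESTIMATE for bounded fields.** For `v ∈ C²(ℝ³; ℝ³)` divergence free with
`‖v‖ ≤ M` and `‖curl v‖² ∈ L¹`, the full gradient is square integrable: `|Dv|²_F ∈ L¹`. [folklore] -/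
theorem integrable_frobeniusNormSq_fderiv_of_bounded (hv : ContDiff ℝ 2 v)
    (hdiv : VectorCalculus.IsDivFree v) {M : ℝ} (hM : ∀ y, ‖v y‖ ≤ M)
    (hω2 : Integrable fun y => ‖curl v y‖ ^ 2) :
    Integrable fun x => frobeniusNormSq (fderiv ℝ v x) := by
  obtain ⟨c, hw6⟩ := exists_const_integrable_pow_six hv hdiv hM hω2
  have hv1 : ContDiff ℝ 1 v := hv.of_le (by norm_num)
  have hwc : Continuous fun x => v x - c := hv.continuous.sub continuous_const
  set S : EuclideanSpace ℝ (Fin 3) → ℝ := fun x => frobeniusNormSq (fderiv ℝ v x) with hS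
  have hSc : Continuous S := continuous_frobeniusNormSq_fderiv hv1 one_ne_zero
  have hS0 : ∀ x, 0 ≤ S x := fun x => frobeniusNormSq_nonneg _
  have hCuc : Continuous fun x => ‖curl v x‖ ^ 2 := (continuous_norm.comp (continuous_curl hv1)).pow 2
  obtain ⟨C₂, hC₂0, hC₂⟩ := exists_norm_fderiv_fderiv_cutoff_le_indicator (E := EuclideanSpace ℝ (Fin 3))
  set V₁ : ℝ := (volume (ball (0 : EuclideanSpace ℝ (Fin 3)) 1)).toReal with hV₁
  set Z : ℝ := ∫ x, ‖curl v x‖ ^ 2 with hZ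
  set N : ℝ := ∫ x, ‖v x - c‖ ^ 6 with hN
  have hN0 : 0 ≤ N := integral_nonneg fun x => by positivity
  -- the cut-off bound, uniform in `R` (layer parameter `a = 1`)
  have hbound : ∀ R : ℝ, 1 ≤ R →
      ∫ x, cutoff R x * S x ≤ (Z + (8 * C₂ * V₁ + C₂ * N)) + (fun _ : ℝ => (0 : ℝ)) R := by
    intro R hR
    have hR0 : 0 < R := by linarith
    have hχ : ContDiff ℝ 2 (cutoff (E := EuclideanSpace ℝ (Fin 3)) R) := contDiff_cutoff R
    have hχc : HasCompactSupport (cutoff (E := EuclideanSpace ℝ (Fin 3)) R) := hasCompactSupport_cutoff hR0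
    have hid := integral_mul_frobeniusNormSq_sub_eq_hessian_sub_const hv1 hdiv hχ hχc c
    have hiS : Integrable fun x => cutoff R x * S x :=
      (hχ.continuous.mul hSc).integrable_of_hasCompactSupport hχc.mul_right
    have hiC : Integrable fun x => cutoff R x * ‖curl v x‖ ^ 2 :=
      (hχ.continuous.mul hCuc).integrable_of_hasCompactSupport hχc.mul_right
    have hsplit : ∫ x, cutoff R x * S x =
        (∫ x, cutoff R x * ‖curl v x‖ ^ 2) + ∫ x, cutoff R x * (S x - ‖curl v x‖ ^ 2) := by
      rw [← integral_add hiC (hiS.sub hiC |>.congr ?_)]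
      · exact integral_congr_ae (ae_of_all _ fun x => by ring)
      · exact ae_of_all _ fun x => by simp only [Pi.sub_apply]; ring
    have h1 : ∫ x, cutoff R x * ‖curl v x‖ ^ 2 ≤ Z := by
      refine integral_mono_of_nonneg (ae_of_all _ fun x => ?_) hω2 (ae_of_all _ fun x => ?_)
      · exact mul_nonneg (cutoff_nonneg R x) (sq_nonneg _)
      · exact mul_le_of_le_one_left (sq_nonneg _) (cutoff_le_one R x)
    have h2 : ∫ x, cutoff R x * (S x - ‖curl v x‖ ^ 2) ≤ 8 * C₂ * V₁ + C₂ * N := by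
      rw [hid]
      refine (le_abs_self _).trans ((abs_integral_hessian_cutoff_le hwc hw6 hC₂0 hC₂ hR0 one_pos).trans ?_)
      have hsh : ∫ x, (closedBall (0 : EuclideanSpace ℝ (Fin 3)) (2 * R) \ ball 0 R).indicator
          (fun _ => (1 : ℝ)) x * ‖v x - c‖ ^ 6 ≤ N := by
        refine integral_mono_of_nonneg (ae_of_all _ fun x => ?_) hw6 (ae_of_all _ fun x => ?_)
        · exact mul_nonneg (indicator_nonneg (fun _ _ => zero_le_one) x) (by positivity)
        · exact mul_le_of_le_one_left (by positivity)
            (indicator_apply_le' (fun _ => le_rfl) (fun _ => zero_le_one))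
      have hC₂' : 0 ≤ C₂ * (1 : ℝ)⁻¹ ^ 2 := by positivity
      have := mul_le_mul_of_nonneg_left hsh hC₂'
      simp only [inv_one, one_pow, mul_one] at this ⊢
      linarith
    rw [hsplit]
    show _ ≤ (Z + (8 * C₂ * V₁ + C₂ * N)) + 0
    linarith
  have hlin := lintegral_ofReal_le_of_forall_integral_cutoff_mul_le hSc hS0 tendsto_const_nhds hbound
  refine ⟨hSc.aestronglyMeasurable, ?_⟩
  rw [hasFiniteIntegral_iff_ofReal (ae_of_all _ hS0)]
  exact hlin.trans_lt ENNReal.ofReal_lt_top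

/-- **The `L²` div–curl IDENTITY for bounded fields.** For `v ∈ C²(ℝ³; ℝ³)` divergence free with
`‖v‖ ≤ M` and `‖curl v‖² ∈ L¹`: `∫ |Dv|²_F = ∫ ‖curl v‖²` — the enstrophy controls the full gradient
with constant one, with NO decay hypothesis on `v`. [folklore] -/
theorem integral_frobeniusNormSq_fderiv_eq_of_bounded (hv : ContDiff ℝ 2 v)
    (hdiv : VectorCalculus.IsDivFree v) {M : ℝ} (hM : ∀ y, ‖v y‖ ≤ M)
    (hω2 : Integrable fun y => ‖curl v y‖ ^ 2) :
    ∫ x, frobeniusNormSq (fderiv ℝ v x) = ∫ x, ‖curl v x‖ ^ 2 := by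
  have hD := integrable_frobeniusNormSq_fderiv_of_bounded hv hdiv hM hω2
  obtain ⟨c, hw6⟩ := exists_const_integrable_pow_six hv hdiv hM hω2
  have hv1 : ContDiff ℝ 1 v := hv.of_le (by norm_num)
  have hwc : Continuous fun x => v x - c := hv.continuous.sub continuous_const
  set S : EuclideanSpace ℝ (Fin 3) → ℝ := fun x => frobeniusNormSq (fderiv ℝ v x) with hS
  have hSc : Continuous S := continuous_frobeniusNormSq_fderiv hv1 one_ne_zero
  have hCuc : Continuous fun x => ‖curl v x‖ ^ 2 := (continuous_norm.comp (continuous_curl hv1)).pow 2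
  obtain ⟨C₂, hC₂0, hC₂⟩ := exists_norm_fderiv_fderiv_cutoff_le_indicator (E := EuclideanSpace ℝ (Fin 3))
  set V₁ : ℝ := (volume (ball (0 : EuclideanSpace ℝ (Fin 3)) 1)).toReal with hV₁
  have hV₁0 : 0 ≤ V₁ := ENNReal.toReal_nonneg
  -- the cut-off integrals `T R = ∫ χ_R (S − ‖curl v‖²)` and the shell tails `ε R`
  set T : ℝ → ℝ := fun R => ∫ x, cutoff R x * (S x - ‖curl v x‖ ^ 2) with hT
  set ε : ℝ → ℝ := fun R => ∫ x, (closedBall (0 : EuclideanSpace ℝ (Fin 3)) (2 * R) \ ball 0 R).indicator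
      (fun _ => (1 : ℝ)) x * ‖v x - c‖ ^ 6 with hε
  have hε0 : Tendsto ε atTop (𝓝 0) := tendsto_integral_shell_pow_six hwc hw6
  -- the error bound for every `a > 0`
  have hTle : ∀ R : ℝ, 0 < R → ∀ a : ℝ, 0 < a → |T R| ≤ 8 * C₂ * V₁ * a + C₂ * a⁻¹ ^ 2 * ε R := by
    intro R hR a ha
    have hχ : ContDiff ℝ 2 (cutoff (E := EuclideanSpace ℝ (Fin 3)) R) := contDiff_cutoff R
    have hχc : HasCompactSupport (cutoff (E := EuclideanSpace ℝ (Fin 3)) R) := hasCompactSupport_cutoff hR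
    have hid := integral_mul_frobeniusNormSq_sub_eq_hessian_sub_const hv1 hdiv hχ hχc c
    show |∫ x, cutoff R x * (S x - ‖curl v x‖ ^ 2)| ≤ _
    rw [hid]
    exact abs_integral_hessian_cutoff_le hwc hw6 hC₂0 hC₂ hR ha
  -- hence `T R → 0`
  have hT0 : Tendsto T atTop (𝓝 0) := by
    rw [Metric.tendsto_atTop]
    intro η hη
    set a : ℝ := η / (2 * (8 * C₂ * V₁ + 1)) with ha
    have hK0 : 0 < 8 * C₂ * V₁ + 1 := by positivity
    have ha0 : 0 < a := by positivity
    have h1 : 8 * C₂ * V₁ * a ≤ η / 2 := by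
      have : 8 * C₂ * V₁ * a ≤ (8 * C₂ * V₁ + 1) * a :=
        mul_le_mul_of_nonneg_right (by linarith) ha0.le
      have e : (8 * C₂ * V₁ + 1) * a = η / 2 := by
        rw [ha]; field_simp
      linarith
    have h2 : ∀ᶠ R in atTop, C₂ * a⁻¹ ^ 2 * ε R < η / 2 := by
      have h := hε0.const_mul (C₂ * a⁻¹ ^ 2)
      rw [mul_zero] at h
      exact (tendsto_order.1 h).2 _ (by positivity)
    obtain ⟨N, hN⟩ := (h2.and (eventually_gt_atTop 0)).exists_forall_of_atTop
    refine ⟨N, fun R hR => ?_⟩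
    obtain ⟨hR2, hR0⟩ := hN R hR
    rw [dist_zero_right, Real.norm_eq_abs]
    calc |T R| ≤ 8 * C₂ * V₁ * a + C₂ * a⁻¹ ^ 2 * ε R := hTle R hR0 a ha0
      _ < η / 2 + η / 2 := by linarith
      _ = η := by ring
  -- and `T R → ∫ (S − ‖curl v‖²)` (dominated convergence, `χ_R → 1`)
  have hTlim : Tendsto T atTop (𝓝 (∫ x, (S x - ‖curl v x‖ ^ 2))) := by
    refine tendsto_integral_filter_of_dominated_convergence (fun x => S x + ‖curl v x‖ ^ 2) ?_ ?_
      (hD.add hω2) ?_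
    · refine Eventually.of_forall fun R => ?_
      exact ((contDiff_cutoff (n := 1) R).continuous.mul (hSc.sub hCuc)).aestronglyMeasurable
    · refine Eventually.of_forall fun R => Eventually.of_forall fun x => ?_
      rw [norm_mul, Real.norm_eq_abs, Real.norm_eq_abs]
      calc |cutoff R x| * |S x - ‖curl v x‖ ^ 2| ≤ 1 * (S x + ‖curl v x‖ ^ 2) := by
            refine mul_le_mul (abs_cutoff_le_one R x) (abs_sub _ _ |>.trans ?_) (abs_nonneg _) zero_le_one
            rw [abs_of_nonneg (frobeniusNormSq_nonneg _), abs_of_nonneg (sq_nonneg _)]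
        _ = S x + ‖curl v x‖ ^ 2 := one_mul _
    · refine Eventually.of_forall fun x => ?_
      refine tendsto_const_nhds.congr' ?_
      filter_upwards [eventually_cutoff_eq_one x] with R hR
      rw [hR, one_mul]
  have h := tendsto_nhds_unique hTlim hT0
  rw [integral_sub hD hω2] at h
  linarith

/-- ★ **Registered-class reading** (the binders of `StretchingDepletion`): for `u ∈ C²(ℝ³; ℝ³)`
divergence free with `‖u‖ ≤ M` and `∫‖curl u‖² < ∞`, `|Du|²_F ∈ L¹` with `∫|Du|²_F = ∫‖curl u‖²`.
Together with p817327 (`…C1DivCurl.integrable_frobeniusNormSq_fderiv_curl_of_contDiff_two`) this is the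
pair of `L²` identities (`‖∇u‖₂ = ‖ω‖₂`, `‖∇ω‖₂ = ‖curl ω‖₂`) the strain-cube chain consumes. [folklore] -/
theorem registered_gradient_sq_integrable_and_eq
    {u : EuclideanSpace ℝ (Fin 3) → EuclideanSpace ℝ (Fin 3)} {M : ℝ} (hu : ContDiff ℝ 2 u)
    (hdiv : VectorCalculus.IsDivFree u) (hM : ∀ x, ‖u x‖ ≤ M)
    (hZ : Integrable fun x => ‖curl u x‖ ^ 2) :
    Integrable (fun x => frobeniusNormSq (fderiv ℝ u x)) ∧
      ∫ x, frobeniusNormSq (fderiv ℝ u x) = ∫ x, ‖curl u x‖ ^ 2 :=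
  ⟨integrable_frobeniusNormSq_fderiv_of_bounded hu hdiv hM hZ,
    integral_frobeniusNormSq_fderiv_eq_of_bounded hu hdiv hM hZ⟩

end Main

end Summit.NavierStokesRegularity.NavierStokesRegularity.Theorems.DepletionLadder.BoundedDivCurl

end
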